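import Mathlib.MeasureTheory.Measure.Tilted
import Mathlib.Analysis.Calculus.ParametricIntegral
import Mathlib.Analysis.SpecialFunctions.ExpDeriv
import Mathlib.Analysis.Calculus.Deriv.Inv
import HarnessLib

/-!
# Route `ToronCumulantSign`, crux `OneSiteCovDerivative` (stmt-QuantumFields-27531) — helper I:
# the first cumulant of a Gibbs tilt: `d/dt|₀ ∫ H d(π tilted by tX) = E[HX] − E[H]E[X]`

For a probability measure `π`, a bounded measurable "action" `X` and a bounded measurable observable `H`, the tilted mean
`t ↦ ∫ H d(π.tilted (t·X)) = (∫ H e^{tX} dπ)/(∫ e^{tX} dπ)` is differentiable at `t = 0` with derivative the covariance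
`∫ H X dπ − (∫ H dπ)(∫ X dπ)` (dominated differentiation under the integral sign + the quotient rule).  This is the measure-
theoretic packaging of "differentiate a tilted product-Haar expectation at `β = 0`" asked for by the route text; the lattice
bookkeeping is in the sibling files.  HONEST LABEL: an elementary calculus lemma; helper toward the OPEN crux `OneSiteCovDerivative`;
nothing about the Yang–Mills mass gap.

References: S. Friedli, Y. Velenik, *Statistical Mechanics of Lattice Systems* (2017) §3.2 (derivatives of the pressure /
cumulants); Mathlib `MeasureTheory.integral_tilted`, `hasDerivAt_integral_of_dominated_loc_of_deriv_le`.
-/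

noncomputable section

open MeasureTheory Filter Set

namespace Summit.QuantumFields.YangMills.Theorems.ToronCumulantSign

section Tilt

variable {Ω : Type*} [MeasurableSpace Ω] {μ : Measure Ω} [IsProbabilityMeasure μ] {X H : Ω → ℝ} {CX CH : ℝ}

/-- **Differentiation under the integral sign**: `t ↦ ∫ e^{tX} H dπ` has derivative `∫ X H dπ` at `t = 0` for bounded measurable
`X, H`. [folklore] -/
theorem hasDerivAt_integral_exp_mul_mul (hX : Measurable X) (hH : Measurable H) (hXb : ∀ ω, |X ω| ≤ CX)
    (hHb : ∀ ω, |H ω| ≤ CH) :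
    HasDerivAt (fun t : ℝ => ∫ ω, Real.exp (t * X ω) * H ω ∂μ) (∫ ω, X ω * H ω ∂μ) 0 := by
  -- the parametric integrand and its derivative
  set F : ℝ → Ω → ℝ := fun t ω => Real.exp (t * X ω) * H ω with hF
  set F' : ℝ → Ω → ℝ := fun t ω => X ω * Real.exp (t * X ω) * H ω with hF'
  have hmeasF : ∀ t, AEStronglyMeasurable (F t) μ := fun t =>
    (((measurable_const.mul hX).exp).mul hH).aestronglyMeasurable
  have hmeasF' : ∀ t, AEStronglyMeasurable (F' t) μ := fun t =>
    ((hX.mul ((measurable_const.mul hX).exp)).mul hH).aestronglyMeasurable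
  have hF0 : Integrable (F 0) μ := by
    refine Integrable.of_bound (hmeasF 0) CH (ae_of_all _ fun ω => ?_)
    simp only [hF, zero_mul, Real.exp_zero, one_mul, Real.norm_eq_abs]
    exact hHb ω
  have hbound : ∀ᵐ ω ∂μ, ∀ t ∈ Metric.ball (0 : ℝ) 1, ‖F' t ω‖ ≤ CX * Real.exp CX * CH := by
    refine ae_of_all _ fun ω t ht => ?_
    have hCX : 0 ≤ CX := (abs_nonneg _).trans (hXb ω)
    rw [Metric.mem_ball, dist_zero_right, Real.norm_eq_abs] at ht
    simp only [hF', Real.norm_eq_abs, abs_mul, Real.abs_exp]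
    have h1 : Real.exp (t * X ω) ≤ Real.exp CX := by
      rw [Real.exp_le_exp]
      calc t * X ω ≤ |t * X ω| := le_abs_self _
        _ = |t| * |X ω| := abs_mul _ _
        _ ≤ 1 * CX := mul_le_mul ht.le (hXb ω) (abs_nonneg _) zero_le_one
        _ = CX := one_mul _
    calc |X ω| * Real.exp (t * X ω) * |H ω| ≤ CX * Real.exp CX * CH :=
        mul_le_mul (mul_le_mul (hXb ω) h1 (Real.exp_pos _).le hCX) (hHb ω) (abs_nonneg _) (by positivity)
      _ = CX * Real.exp CX * CH := rfl
  have hdiff : ∀ᵐ ω ∂μ, ∀ t ∈ Metric.ball (0 : ℝ) 1, HasDerivAt (F · ω) (F' t ω) t := by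
    refine ae_of_all _ fun ω t _ => ?_
    simp only [hF, hF']
    have h := ((hasDerivAt_id t).mul_const (X ω)).exp.mul_const (H ω)
    simpa [mul_comm] using h
  have h := (hasDerivAt_integral_of_dominated_loc_of_deriv_le (Metric.ball_mem_nhds (0 : ℝ) zero_lt_one)
    (Eventually.of_forall hmeasF) hF0 (hmeasF' 0) hbound (integrable_const _) hdiff).2
  simpa [hF, hF'] using h

omit [IsProbabilityMeasure μ] in
/-- **The tilted mean as a quotient**: `∫ H d(μ.tilted (tX)) = (∫ e^{tX} H dμ)/(∫ e^{tX} dμ)`. [folklore] -/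
theorem integral_tilted_mul_eq_div (t : ℝ) :
    ∫ ω, H ω ∂(μ.tilted fun ω => t * X ω) =
      (∫ ω, Real.exp (t * X ω) * H ω ∂μ) / ∫ ω, Real.exp (t * X ω) ∂μ := by
  rw [integral_tilted]
  simp only [smul_eq_mul]
  rw [div_eq_inv_mul, ← integral_const_mul]
  refine integral_congr_ae (ae_of_all _ fun ω => ?_)
  simp only
  ring

/-- ★ **The first cumulant of a Gibbs tilt**: for bounded measurable `X, H` on a probability space,
`d/dt|₀ ∫ H d(μ.tilted (t·X)) = ∫ H X dπ − (∫ H dπ)(∫ X dπ)`. [folklore] -/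
theorem hasDerivAt_integral_tilted_zero (hX : Measurable X) (hH : Measurable H) (hXb : ∀ ω, |X ω| ≤ CX)
    (hHb : ∀ ω, |H ω| ≤ CH) :
    HasDerivAt (fun t : ℝ => ∫ ω, H ω ∂(μ.tilted fun ω => t * X ω))
      ((∫ ω, H ω * X ω ∂μ) - (∫ ω, H ω ∂μ) * (∫ ω, X ω ∂μ)) 0 := by
  have hN := hasDerivAt_integral_exp_mul_mul (μ := μ) hX hH hXb hHb
  have h1b : ∀ ω, |(fun _ : Ω => (1 : ℝ)) ω| ≤ 1 := fun ω => by simp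
  have hZ := hasDerivAt_integral_exp_mul_mul (μ := μ) hX measurable_const hXb h1b
  simp only [mul_one] at hZ
  have hZ0 : (∫ ω, Real.exp (0 * X ω) ∂μ) = 1 := by simp
  have hN0 : (∫ ω, Real.exp (0 * X ω) * H ω ∂μ) = ∫ ω, H ω ∂μ := by simp
  have hq := hN.div hZ (by rw [hZ0]; exact one_ne_zero)
  rw [hZ0, hN0] at hq
  have hfun : (fun t : ℝ => ∫ ω, H ω ∂(μ.tilted fun ω => t * X ω)) =
      fun t => (∫ ω, Real.exp (t * X ω) * H ω ∂μ) / ∫ ω, Real.exp (t * X ω) ∂μ := by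
    funext t; exact integral_tilted_mul_eq_div t
  rw [hfun]
  refine hq.congr_deriv ?_
  simp only [one_pow, div_one, mul_one]
  rw [show (∫ ω, X ω * H ω ∂μ) = ∫ ω, H ω * X ω ∂μ from integral_congr_ae (ae_of_all _ fun ω => mul_comm _ _)]

end Tilt

end Summit.QuantumFields.YangMills.Theorems.ToronCumulantSign
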